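import Summits.CriticalPhenomena.PercolationContinuityZ3.Theorems.PercNearOneGluingNoHeavyLowerTailKnQuestion8CoefficientwiseCoreClassKernelMixFibreFlow
import HarnessLib

/-!
# Two fibrewise flows with joins, II: the assembly (abstract 'flows + joins')

Support file (`--supports stmt-CriticalPhenomena-4575`, closed), prover `prim-cplus-coupling` (gen 42).  No definitions, no notations, no named facts,
no sorries; standard axioms.  Memo `prim-cplus-coupling/A5-COUPLING-gen42.md` §7.  Setting and notation: see part I (…KernelMixFibreFlow).

THEOREM `Coefficientwise.fibre_flows_joins`: with `P, Q, O` pairwise disjoint, `𝒱` up-closed, `hbo`/`kbo` antitone, an injective lift on `O`-words,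
`D ω = (ω∩P ≠ P ∧ ω∩Q ≠ Q ∧ noF(ω∩O) ∧ (ω∩P = ∅ ∨ ω∩Q = ∅ ∨ hasE(ω∩O)))`, `bad₁ = D ∧ hro ∧ kbo`, `bad₂ = D ∧ hbo ∧ kro`, joins `P₁ = D ∧ hro ∧ kro`:
  `#(𝒱 ∩ bad₁) + #(𝒱 ∩ bad₂) ≤ #(𝒱 ∩ (T₁ ∪ T₂)) + #(𝒱 ∩ P₁)`
for the explicit flow images `T₁, T₂` (lifted landing points of `fibre_flow_landing` applied to the `Q`-word, resp. the `P`-word).  The two images are hit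
injectively; a point hit by both flows comes from one landing index, which is a join in `𝒱` — the 'twin-square' mechanism of the memo (§1.1, §7).
On a bundle with thread-supported levels `T₁ ∪ T₂ ⊆ L₁ ∪ L₂ ⊆ S` (cluster-trace glue, not in this file), giving THEOREM LP1(Θ) of the memo and, with
`iet_graph_of_indicator_levels`, IET(Θ) for thread-additive levels.
-/

namespace Summit.CriticalPhenomena.PercolationContinuityZ3.Theorems

open Finset

namespace Coefficientwise

variable {ι : Type*}

open Classical in
/-- **Two fibrewise flows with joins (abstract 'flows + joins').**  Setting of the module docstring: `P, Q, O` pairwise disjoint; `𝒱` up-closed;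
`hbo` antitone on `P`-words, `kbo` antitone on `Q`-words; `lift` injective on `O`-words with `noF` and `η ⊆ lift η ⊆ O`.  With
`D ω = (ω∩P ≠ P ∧ ω∩Q ≠ Q ∧ noF(ω∩O) ∧ (ω∩P = ∅ ∨ ω∩Q = ∅ ∨ hasE(ω∩O)))`, `bad₁ = D ∧ hro ∧ kbo`, `bad₂ = D ∧ hbo ∧ kro`, `P₁ = D ∧ hro ∧ kro` and the
explicit flow images `T₁` (words: `hro(ω∩P)`, `kbo(Q∖ω)`, `ω∩P ≠ P`, `ω∩Q ≠ ∅`, `ω∩O = lift η` for some `η ⊆ O` with `noF η` and `(ω∩P = ∅ ∨ ω∩Q = Q ∨ hasE η)`)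
and `T₂` (symmetric), for every up-closed `𝒱`:
  `#(𝒱 ∩ bad₁) + #(𝒱 ∩ bad₂) ≤ #(𝒱 ∩ (T₁ ∪ T₂)) + #(𝒱 ∩ P₁)`.
Proof: `fibre_flow_landing` twice; the landing pairs map injectively to `T₁` (resp. `T₂`) by `(ρ, γ′) ↦ (ρ∩P) ∪ γ′ ∪ lift(ρ∩O)`; a point hit by both
flows comes from the same landing index `γ′ ∪ ρ`, which is a join (`P₁`) in `𝒱`; inclusion–exclusion.  (Memo gen 42 §7.)
[cite: KozmaNitzan2024, Questions 8–9 (§5.5 p. 36) (context); Harris 1960] -/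
theorem fibre_flows_joins [DecidableEq ι] (P Q O : Finset ι) (hPQ : Disjoint P Q) (hPO : Disjoint P O) (hQO : Disjoint Q O)
    (𝒱 : Finset ι → Prop) (hV : ∀ ⦃s t : Finset ι⦄, s ⊆ t → 𝒱 s → 𝒱 t)
    (hro hbo kro kbo : Finset ι → Prop) (noF hasE : Finset ι → Prop) (lift : Finset ι → Finset ι)
    (hbo_anti : ∀ a a' : Finset ι, a ⊆ a' → a' ⊆ P → hbo a' → hbo a)
    (kbo_anti : ∀ γ γ' : Finset ι, γ ⊆ γ' → γ' ⊆ Q → kbo γ' → kbo γ)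
    (lift_sub : ∀ η, η ⊆ O → lift η ⊆ O) (sub_lift : ∀ η, η ⊆ O → η ⊆ lift η)
    (lift_inj : ∀ η η', η ⊆ O → η' ⊆ O → noF η → noF η' → lift η = lift η' → η = η') :
    (∑ ω ∈ (P ∪ Q ∪ O).powerset,
        if 𝒱 ω ∧ ((ω ∩ P ≠ P ∧ ω ∩ Q ≠ Q ∧ noF (ω ∩ O) ∧ (ω ∩ P = ∅ ∨ ω ∩ Q = ∅ ∨ hasE (ω ∩ O))) ∧ hro (ω ∩ P) ∧ kbo (ω ∩ Q))
        then (1 : ℝ) else 0)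
    + (∑ ω ∈ (P ∪ Q ∪ O).powerset,
        if 𝒱 ω ∧ ((ω ∩ P ≠ P ∧ ω ∩ Q ≠ Q ∧ noF (ω ∩ O) ∧ (ω ∩ P = ∅ ∨ ω ∩ Q = ∅ ∨ hasE (ω ∩ O))) ∧ hbo (ω ∩ P) ∧ kro (ω ∩ Q))
        then (1 : ℝ) else 0)
    ≤ (∑ ω ∈ (P ∪ Q ∪ O).powerset,
        if 𝒱 ω ∧ ((hro (ω ∩ P) ∧ kbo (Q \ ω) ∧ ω ∩ P ≠ P ∧ ω ∩ Q ≠ ∅ ∧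
                      ∃ η, η ⊆ O ∧ noF η ∧ lift η = ω ∩ O ∧ (ω ∩ P = ∅ ∨ ω ∩ Q = Q ∨ hasE η))
                  ∨ (kro (ω ∩ Q) ∧ hbo (P \ ω) ∧ ω ∩ Q ≠ Q ∧ ω ∩ P ≠ ∅ ∧
                      ∃ η, η ⊆ O ∧ noF η ∧ lift η = ω ∩ O ∧ (ω ∩ Q = ∅ ∨ ω ∩ P = P ∨ hasE η)))
        then (1 : ℝ) else 0)
    + ∑ ω ∈ (P ∪ Q ∪ O).powerset,
        if 𝒱 ω ∧ ((ω ∩ P ≠ P ∧ ω ∩ Q ≠ Q ∧ noF (ω ∩ O) ∧ (ω ∩ P = ∅ ∨ ω ∩ Q = ∅ ∨ hasE (ω ∩ O))) ∧ hro (ω ∩ P) ∧ kro (ω ∩ Q))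
        then (1 : ℝ) else 0 := by
  -- the two landing bounds
  have hE1 : P ∪ Q ∪ O = Q ∪ (P ∪ O) := by
    ext x; simp only [Finset.mem_union]; tauto
  have hE2 : P ∪ Q ∪ O = P ∪ (Q ∪ O) := by
    ext x; simp only [Finset.mem_union]; tauto
  have f1 := fibre_flow_landing P Q O hPQ hQO 𝒱 hV hro kbo noF hasE kbo_anti
  have f2 := fibre_flow_landing Q P O hPQ.symm hPO 𝒱 hV kro hbo noF hasE hbo_anti
  rw [← hE1] at f1
  rw [← hE2] at f2
  -- flow 2's source is bad₂ up to reordering the conjuncts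
  have f2' : (∑ ω ∈ (P ∪ Q ∪ O).powerset,
        if 𝒱 ω ∧ ((ω ∩ P ≠ P ∧ ω ∩ Q ≠ Q ∧ noF (ω ∩ O) ∧ (ω ∩ P = ∅ ∨ ω ∩ Q = ∅ ∨ hasE (ω ∩ O))) ∧ hbo (ω ∩ P) ∧ kro (ω ∩ Q))
        then (1 : ℝ) else 0)
      ≤ ∑ ρ ∈ (Q ∪ O).powerset, ∑ γ ∈ P.powerset,
        if 𝒱 (γ ∪ ρ) ∧ kro (ρ ∩ Q) ∧ hbo (P \ γ) ∧ (ρ ∩ Q ≠ Q ∧ P \ γ ≠ P ∧ noF (ρ ∩ O) ∧ (ρ ∩ Q = ∅ ∨ P \ γ = ∅ ∨ hasE (ρ ∩ O)))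
        then (1 : ℝ) else 0 := by
    refine le_trans (le_of_eq ?_) f2
    refine Finset.sum_congr rfl fun ω _ => ?_
    exact if_congr (by tauto) rfl rfl
  -- landing sets as finsets of pairs
  set L1 : Finset (Finset ι × Finset ι) := ((P ∪ O).powerset ×ˢ Q.powerset).filter (fun x =>
      𝒱 (x.2 ∪ x.1) ∧ hro (x.1 ∩ P) ∧ kbo (Q \ x.2) ∧ (x.1 ∩ P ≠ P ∧ Q \ x.2 ≠ Q ∧ noF (x.1 ∩ O) ∧ (x.1 ∩ P = ∅ ∨ Q \ x.2 = ∅ ∨ hasE (x.1 ∩ O)))) with hL1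
  set L2 : Finset (Finset ι × Finset ι) := ((Q ∪ O).powerset ×ˢ P.powerset).filter (fun x =>
      𝒱 (x.2 ∪ x.1) ∧ kro (x.1 ∩ Q) ∧ hbo (P \ x.2) ∧ (x.1 ∩ Q ≠ Q ∧ P \ x.2 ≠ P ∧ noF (x.1 ∩ O) ∧ (x.1 ∩ Q = ∅ ∨ P \ x.2 = ∅ ∨ hasE (x.1 ∩ O)))) with hL2
  have cL1 : (∑ ρ ∈ (P ∪ O).powerset, ∑ γ ∈ Q.powerset,
        if 𝒱 (γ ∪ ρ) ∧ hro (ρ ∩ P) ∧ kbo (Q \ γ) ∧ (ρ ∩ P ≠ P ∧ Q \ γ ≠ Q ∧ noF (ρ ∩ O) ∧ (ρ ∩ P = ∅ ∨ Q \ γ = ∅ ∨ hasE (ρ ∩ O)))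
        then (1 : ℝ) else 0) = (L1.card : ℝ) := by
    rw [hL1, ← Finset.sum_product (s := (P ∪ O).powerset) (t := Q.powerset)
      (f := fun x => if 𝒱 (x.2 ∪ x.1) ∧ hro (x.1 ∩ P) ∧ kbo (Q \ x.2) ∧ (x.1 ∩ P ≠ P ∧ Q \ x.2 ≠ Q ∧ noF (x.1 ∩ O) ∧ (x.1 ∩ P = ∅ ∨ Q \ x.2 = ∅ ∨ hasE (x.1 ∩ O))) then (1 : ℝ) else 0)]
    rw [Finset.sum_boole]
  have cL2 : (∑ ρ ∈ (Q ∪ O).powerset, ∑ γ ∈ P.powerset,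
        if 𝒱 (γ ∪ ρ) ∧ kro (ρ ∩ Q) ∧ hbo (P \ γ) ∧ (ρ ∩ Q ≠ Q ∧ P \ γ ≠ P ∧ noF (ρ ∩ O) ∧ (ρ ∩ Q = ∅ ∨ P \ γ = ∅ ∨ hasE (ρ ∩ O)))
        then (1 : ℝ) else 0) = (L2.card : ℝ) := by
    rw [hL2, ← Finset.sum_product (s := (Q ∪ O).powerset) (t := P.powerset)
      (f := fun x => if 𝒱 (x.2 ∪ x.1) ∧ kro (x.1 ∩ Q) ∧ hbo (P \ x.2) ∧ (x.1 ∩ Q ≠ Q ∧ P \ x.2 ≠ P ∧ noF (x.1 ∩ O) ∧ (x.1 ∩ Q = ∅ ∨ P \ x.2 = ∅ ∨ hasE (x.1 ∩ O))) then (1 : ℝ) else 0)]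
    rw [Finset.sum_boole]
  -- the lifts
  set m1 : Finset ι × Finset ι → Finset ι := fun x => (x.1 ∩ P) ∪ x.2 ∪ lift (x.1 ∩ O) with hm1
  set m2 : Finset ι × Finset ι → Finset ι := fun x => x.2 ∪ (x.1 ∩ Q) ∪ lift (x.1 ∩ O) with hm2
  -- membership unpacking
  have memL1 : ∀ x ∈ L1, x.1 ⊆ P ∪ O ∧ x.2 ⊆ Q ∧ 𝒱 (x.2 ∪ x.1) ∧ hro (x.1 ∩ P) ∧ kbo (Q \ x.2) ∧
      (x.1 ∩ P ≠ P ∧ Q \ x.2 ≠ Q ∧ noF (x.1 ∩ O) ∧ (x.1 ∩ P = ∅ ∨ Q \ x.2 = ∅ ∨ hasE (x.1 ∩ O))) := by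
    intro x hx
    rw [hL1, Finset.mem_filter, Finset.mem_product, Finset.mem_powerset, Finset.mem_powerset] at hx
    exact ⟨hx.1.1, hx.1.2, hx.2⟩
  have memL2 : ∀ x ∈ L2, x.1 ⊆ Q ∪ O ∧ x.2 ⊆ P ∧ 𝒱 (x.2 ∪ x.1) ∧ kro (x.1 ∩ Q) ∧ hbo (P \ x.2) ∧
      (x.1 ∩ Q ≠ Q ∧ P \ x.2 ≠ P ∧ noF (x.1 ∩ O) ∧ (x.1 ∩ Q = ∅ ∨ P \ x.2 = ∅ ∨ hasE (x.1 ∩ O))) := by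
    intro x hx
    rw [hL2, Finset.mem_filter, Finset.mem_product, Finset.mem_powerset, Finset.mem_powerset] at hx
    exact ⟨hx.1.1, hx.1.2, hx.2⟩
  -- words of the lifted points
  have w1 : ∀ x ∈ L1, m1 x ∩ P = x.1 ∩ P ∧ m1 x ∩ Q = x.2 ∧ m1 x ∩ O = lift (x.1 ∩ O) := by
    intro x hx
    obtain ⟨_, h2, -⟩ := memL1 x hx
    exact words_of_union3 hPQ hPO hQO Finset.inter_subset_right h2 (lift_sub _ Finset.inter_subset_right)
  have w2 : ∀ x ∈ L2, m2 x ∩ P = x.2 ∧ m2 x ∩ Q = x.1 ∩ Q ∧ m2 x ∩ O = lift (x.1 ∩ O) := by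
    intro x hx
    obtain ⟨_, h2, -⟩ := memL2 x hx
    exact words_of_union3 hPQ hPO hQO h2 Finset.inter_subset_right (lift_sub _ Finset.inter_subset_right)
  -- decomposition of ρ ⊆ P ∪ O resp. Q ∪ O
  have splitPO : ∀ ρ : Finset ι, ρ ⊆ P ∪ O → ρ = (ρ ∩ P) ∪ (ρ ∩ O) := by
    intro ρ hρ; ext x; simp only [Finset.mem_union, Finset.mem_inter]
    constructor
    · intro hx; rcases Finset.mem_union.mp (hρ hx) with h | h
      · exact Or.inl ⟨hx, h⟩
      · exact Or.inr ⟨hx, h⟩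
    · rintro (⟨h, _⟩ | ⟨h, _⟩) <;> exact h
  have splitQO : ∀ ρ : Finset ι, ρ ⊆ Q ∪ O → ρ = (ρ ∩ Q) ∪ (ρ ∩ O) := by
    intro ρ hρ; ext x; simp only [Finset.mem_union, Finset.mem_inter]
    constructor
    · intro hx; rcases Finset.mem_union.mp (hρ hx) with h | h
      · exact Or.inl ⟨hx, h⟩
      · exact Or.inr ⟨hx, h⟩
    · rintro (⟨h, _⟩ | ⟨h, _⟩) <;> exact h
  -- injectivity of the lifts
  have inj1 : Set.InjOn m1 ↑L1 := by
    intro x hx y hy hxy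
    have hx' := memL1 x hx; have hy' := memL1 y hy
    obtain ⟨hxP, hxQ, hxO⟩ := w1 x hx; obtain ⟨hyP, hyQ, hyO⟩ := w1 y hy
    have eP : x.1 ∩ P = y.1 ∩ P := by rw [← hxP, ← hyP, hxy]
    have eQ : x.2 = y.2 := by rw [← hxQ, ← hyQ, hxy]
    have eO : x.1 ∩ O = y.1 ∩ O := by
      apply lift_inj _ _ Finset.inter_subset_right Finset.inter_subset_right hx'.2.2.2.2.2.2.2.1 hy'.2.2.2.2.2.2.2.1
      rw [← hxO, ← hyO, hxy]
    have e1 : x.1 = y.1 := by rw [splitPO x.1 hx'.1, splitPO y.1 hy'.1, eP, eO]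
    exact Prod.ext e1 eQ
  have inj2 : Set.InjOn m2 ↑L2 := by
    intro x hx y hy hxy
    have hx' := memL2 x hx; have hy' := memL2 y hy
    obtain ⟨hxP, hxQ, hxO⟩ := w2 x hx; obtain ⟨hyP, hyQ, hyO⟩ := w2 y hy
    have eP : x.2 = y.2 := by rw [← hxP, ← hyP, hxy]
    have eQ : x.1 ∩ Q = y.1 ∩ Q := by rw [← hxQ, ← hyQ, hxy]
    have eO : x.1 ∩ O = y.1 ∩ O := by
      apply lift_inj _ _ Finset.inter_subset_right Finset.inter_subset_right hx'.2.2.2.2.2.2.2.1 hy'.2.2.2.2.2.2.2.1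
      rw [← hxO, ← hyO, hxy]
    have e1 : x.1 = y.1 := by rw [splitQO x.1 hx'.1, splitQO y.1 hy'.1, eQ, eO]
    exact Prod.ext e1 eP
  set Im1 := L1.image m1 with hIm1
  set Im2 := L2.image m2 with hIm2
  have cIm1 : Im1.card = L1.card := Finset.card_image_of_injOn inj1
  have cIm2 : Im2.card = L2.card := Finset.card_image_of_injOn inj2
  -- target filters
  set TT := (P ∪ Q ∪ O).powerset.filter (fun ω => 𝒱 ω ∧ ((hro (ω ∩ P) ∧ kbo (Q \ ω) ∧ ω ∩ P ≠ P ∧ ω ∩ Q ≠ ∅ ∧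
                      ∃ η, η ⊆ O ∧ noF η ∧ lift η = ω ∩ O ∧ (ω ∩ P = ∅ ∨ ω ∩ Q = Q ∨ hasE η))
                  ∨ (kro (ω ∩ Q) ∧ hbo (P \ ω) ∧ ω ∩ Q ≠ Q ∧ ω ∩ P ≠ ∅ ∧
                      ∃ η, η ⊆ O ∧ noF η ∧ lift η = ω ∩ O ∧ (ω ∩ Q = ∅ ∨ ω ∩ P = P ∨ hasE η)))) with hTT
  set PP := (P ∪ Q ∪ O).powerset.filter (fun ω => 𝒱 ω ∧ ((ω ∩ P ≠ P ∧ ω ∩ Q ≠ Q ∧ noF (ω ∩ O) ∧ (ω ∩ P = ∅ ∨ ω ∩ Q = ∅ ∨ hasE (ω ∩ O)))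
                  ∧ hro (ω ∩ P) ∧ kro (ω ∩ Q))) with hPP
  -- Im1 ∪ Im2 ⊆ TT
  have sub1 : Im1 ⊆ TT := by
    intro ω hω
    rw [hIm1, Finset.mem_image] at hω
    obtain ⟨x, hx, rfl⟩ := hω
    obtain ⟨h1, h2, h3, h4, h5, h6, h7, h8, h9⟩ := memL1 x hx
    obtain ⟨hxP, hxQ, hxO⟩ := w1 x hx
    rw [hTT, Finset.mem_filter, Finset.mem_powerset]
    have hsub : m1 x ⊆ P ∪ Q ∪ O := by
      intro y hy; simp only [hm1, Finset.mem_union] at hy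
      rcases hy with (hy | hy) | hy
      · exact Finset.mem_union_left _ (Finset.mem_union_left _ (Finset.mem_inter.mp hy).2)
      · exact Finset.mem_union_left _ (Finset.mem_union_right _ (h2 hy))
      · exact Finset.mem_union_right _ (lift_sub _ Finset.inter_subset_right hy)
    have hQω : Q \ m1 x = Q \ x.2 := by
      ext y; rw [Finset.mem_sdiff, Finset.mem_sdiff, ← hxQ, Finset.mem_inter]; tauto
    refine ⟨hsub, ?_, Or.inl ⟨?_, ?_, ?_, ?_, ?_⟩⟩
    · -- 𝒱 (m1 x): above the landing index x.2 ∪ x.1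
      apply hV _ h3
      intro y hy; simp only [hm1, Finset.mem_union]
      rcases Finset.mem_union.mp hy with hy | hy
      · exact Or.inl (Or.inr hy)
      · rcases Finset.mem_union.mp (h1 hy) with hP | hO
        · exact Or.inl (Or.inl (Finset.mem_inter.mpr ⟨hy, hP⟩))
        · exact Or.inr (sub_lift _ Finset.inter_subset_right (Finset.mem_inter.mpr ⟨hy, hO⟩))
    · rw [hxP]; exact h4
    · rw [hQω]; exact h5
    · rw [hxP]; exact h6
    · rw [hxQ]; intro h0; apply h7; rw [h0, Finset.sdiff_empty]
    · refine ⟨x.1 ∩ O, Finset.inter_subset_right, h8, hxO.symm, ?_⟩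
      rw [hxP, hxQ]
      rcases h9 with h9 | h9 | h9
      · exact Or.inl h9
      · right; left; exact (Finset.sdiff_eq_empty_iff_subset.mp h9).antisymm' h2 ▸ rfl
      · exact Or.inr (Or.inr h9)
  have sub2 : Im2 ⊆ TT := by
    intro ω hω
    rw [hIm2, Finset.mem_image] at hω
    obtain ⟨x, hx, rfl⟩ := hω
    obtain ⟨h1, h2, h3, h4, h5, h6, h7, h8, h9⟩ := memL2 x hx
    obtain ⟨hxP, hxQ, hxO⟩ := w2 x hx
    rw [hTT, Finset.mem_filter, Finset.mem_powerset]
    have hsub : m2 x ⊆ P ∪ Q ∪ O := by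
      intro y hy; simp only [hm2, Finset.mem_union] at hy
      rcases hy with (hy | hy) | hy
      · exact Finset.mem_union_left _ (Finset.mem_union_left _ (h2 hy))
      · exact Finset.mem_union_left _ (Finset.mem_union_right _ (Finset.mem_inter.mp hy).2)
      · exact Finset.mem_union_right _ (lift_sub _ Finset.inter_subset_right hy)
    have hPω : P \ m2 x = P \ x.2 := by
      ext y; rw [Finset.mem_sdiff, Finset.mem_sdiff, ← hxP, Finset.mem_inter]; tauto
    refine ⟨hsub, ?_, Or.inr ⟨?_, ?_, ?_, ?_, ?_⟩⟩
    · apply hV _ h3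
      intro y hy; simp only [hm2, Finset.mem_union]
      rcases Finset.mem_union.mp hy with hy | hy
      · exact Or.inl (Or.inl hy)
      · rcases Finset.mem_union.mp (h1 hy) with hQ' | hO
        · exact Or.inl (Or.inr (Finset.mem_inter.mpr ⟨hy, hQ'⟩))
        · exact Or.inr (sub_lift _ Finset.inter_subset_right (Finset.mem_inter.mpr ⟨hy, hO⟩))
    · rw [hxQ]; exact h4
    · rw [hPω]; exact h5
    · rw [hxQ]; exact h6
    · rw [hxP]; intro h0; apply h7; rw [h0, Finset.sdiff_empty]
    · refine ⟨x.1 ∩ O, Finset.inter_subset_right, h8, hxO.symm, ?_⟩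
      rw [hxQ, hxP]
      rcases h9 with h9 | h9 | h9
      · exact Or.inl h9
      · right; left; exact (Finset.sdiff_eq_empty_iff_subset.mp h9).antisymm' h2 ▸ rfl
      · exact Or.inr (Or.inr h9)
  have subU : Im1 ∪ Im2 ⊆ TT := Finset.union_subset sub1 sub2
  -- the collisions: J = landing pairs of flow 1 whose lift is also hit by flow 2; they map injectively into PP by the landing index
  set J := L1.filter (fun x => m1 x ∈ Im2) with hJ
  have hJimage : J.image m1 = Im1 ∩ Im2 := by
    ext ω; rw [Finset.mem_image, Finset.mem_inter]; constructor
    · rintro ⟨x, hx, rfl⟩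
      rw [hJ, Finset.mem_filter] at hx
      exact ⟨Finset.mem_image_of_mem _ hx.1, hx.2⟩
    · rintro ⟨hω1, hω2⟩
      rw [hIm1, Finset.mem_image] at hω1
      obtain ⟨x, hx, rfl⟩ := hω1
      exact ⟨x, by rw [hJ, Finset.mem_filter]; exact ⟨hx, hω2⟩, rfl⟩
  have cJ : (Im1 ∩ Im2).card = J.card := by
    rw [← hJimage]; exact Finset.card_image_of_injOn (fun x hx y hy hxy => inj1 (Finset.mem_of_mem_filter x hx) (Finset.mem_of_mem_filter y hy) hxy)
  set idx : Finset ι × Finset ι → Finset ι := fun x => x.2 ∪ x.1 with hidx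
  have injIdx : Set.InjOn idx ↑J := by
    intro x hx y hy hxy
    have hx' := memL1 x (Finset.mem_of_mem_filter x hx); have hy' := memL1 y (Finset.mem_of_mem_filter y hy)
    have hQPO : Disjoint Q (P ∪ O) := by rw [Finset.disjoint_union_right]; exact ⟨hPQ.symm, hQO⟩
    have kQ : ∀ z : Finset ι × Finset ι, z.1 ⊆ P ∪ O → z.2 ⊆ Q → idx z ∩ Q = z.2 := by
      intro z hz1 hz2; ext y; simp only [hidx, Finset.mem_inter, Finset.mem_union]; constructor
      · rintro ⟨h | h, hyQ⟩
        · exact h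
        · exact absurd hyQ (Finset.disjoint_right.mp hQPO (hz1 h))
      · intro h; exact ⟨Or.inl h, hz2 h⟩
    have kR : ∀ z : Finset ι × Finset ι, z.1 ⊆ P ∪ O → z.2 ⊆ Q → idx z ∩ (P ∪ O) = z.1 := by
      intro z hz1 hz2; ext y; simp only [hidx, Finset.mem_inter, Finset.mem_union]; constructor
      · rintro ⟨h | h, hyPO⟩
        · exfalso; rcases hyPO with hyP | hyO
          · exact Finset.disjoint_left.mp hPQ hyP (hz2 h)
          · exact Finset.disjoint_left.mp hQO (hz2 h) hyO
        · exact h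
      · intro h; exact ⟨Or.inr h, Finset.mem_union.mp (hz1 h)⟩
    have e2 : x.2 = y.2 := by rw [← kQ x hx'.1 hx'.2.1, ← kQ y hy'.1 hy'.2.1, hxy]
    have e1 : x.1 = y.1 := by rw [← kR x hx'.1 hx'.2.1, ← kR y hy'.1 hy'.2.1, hxy]
    exact Prod.ext e1 e2
  have subJ : J.image idx ⊆ PP := by
    intro ω hω
    rw [Finset.mem_image] at hω
    obtain ⟨x, hx, rfl⟩ := hω
    rw [hJ, Finset.mem_filter] at hx
    obtain ⟨hx1, hx2⟩ := hx
    obtain ⟨h1, h2, h3, h4, h5, h6, h7, h8, h9⟩ := memL1 x hx1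
    obtain ⟨hxP, hxQ, hxO⟩ := w1 x hx1
    -- the flow-2 preimage
    rw [hIm2, Finset.mem_image] at hx2
    obtain ⟨z, hz, hzx⟩ := hx2
    obtain ⟨g1, g2, g3, g4, g5, g6, g7, g8, g9⟩ := memL2 z hz
    obtain ⟨hzP, hzQ, hzO⟩ := w2 z hz
    have eQ : z.1 ∩ Q = x.2 := by rw [← hzQ, hzx, hxQ]
    have eP : z.2 = x.1 ∩ P := by rw [← hzP, hzx, hxP]
    have eO : z.1 ∩ O = x.1 ∩ O := by
      apply lift_inj _ _ Finset.inter_subset_right Finset.inter_subset_right g8 h8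
      rw [← hzO, hzx, hxO]
    -- words of the landing index
    have hQPO : Disjoint Q (P ∪ O) := by rw [Finset.disjoint_union_right]; exact ⟨hPQ.symm, hQO⟩
    have iQ : idx x ∩ Q = x.2 := by
      ext y; simp only [hidx, Finset.mem_inter, Finset.mem_union]; constructor
      · rintro ⟨h | h, hyQ⟩
        · exact h
        · exact absurd hyQ (Finset.disjoint_right.mp hQPO (h1 h))
      · intro h; exact ⟨Or.inl h, h2 h⟩
    have iP : idx x ∩ P = x.1 ∩ P := by
      ext y; simp only [hidx, Finset.mem_inter, Finset.mem_union]; constructor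
      · rintro ⟨h | h, hyP⟩
        · exact absurd hyP (Finset.disjoint_right.mp hPQ (h2 h))
        · exact ⟨h, hyP⟩
      · rintro ⟨h, hyP⟩; exact ⟨Or.inr h, hyP⟩
    have iO : idx x ∩ O = x.1 ∩ O := by
      ext y; simp only [hidx, Finset.mem_inter, Finset.mem_union]; constructor
      · rintro ⟨h | h, hyO⟩
        · exact absurd hyO (Finset.disjoint_left.mp hQO (h2 h))
        · exact ⟨h, hyO⟩
      · rintro ⟨h, hyO⟩; exact ⟨Or.inr h, hyO⟩
    rw [hPP, Finset.mem_filter, Finset.mem_powerset]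
    have hγQ : x.2 ≠ Q := by rw [← eQ]; exact g6
    refine ⟨?_, h3, ⟨?_, ?_, ?_, ?_⟩, ?_, ?_⟩
    · intro y hy; rcases Finset.mem_union.mp hy with hy | hy
      · exact Finset.mem_union_left _ (Finset.mem_union_right _ (h2 hy))
      · rcases Finset.mem_union.mp (h1 hy) with hP | hO
        · exact Finset.mem_union_left _ (Finset.mem_union_left _ hP)
        · exact Finset.mem_union_right _ hO
    · rw [iP]; exact h6
    · rw [iQ]; exact hγQ
    · rw [iO]; exact h8
    · rw [iP, iQ, iO]
      rcases h9 with h9 | h9 | h9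
      · exact Or.inl h9
      · exfalso; apply hγQ; exact (h2).antisymm (Finset.sdiff_eq_empty_iff_subset.mp h9)
      · exact Or.inr (Or.inr h9)
    · rw [iP]; exact h4
    · rw [iQ, ← eQ]; exact g4
  have cJle : J.card ≤ PP.card := by
    rw [← Finset.card_image_of_injOn injIdx]; exact Finset.card_le_card subJ
  -- assemble
  have eTT : (∑ ω ∈ (P ∪ Q ∪ O).powerset,
        if 𝒱 ω ∧ ((hro (ω ∩ P) ∧ kbo (Q \ ω) ∧ ω ∩ P ≠ P ∧ ω ∩ Q ≠ ∅ ∧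
                      ∃ η, η ⊆ O ∧ noF η ∧ lift η = ω ∩ O ∧ (ω ∩ P = ∅ ∨ ω ∩ Q = Q ∨ hasE η))
                  ∨ (kro (ω ∩ Q) ∧ hbo (P \ ω) ∧ ω ∩ Q ≠ Q ∧ ω ∩ P ≠ ∅ ∧
                      ∃ η, η ⊆ O ∧ noF η ∧ lift η = ω ∩ O ∧ (ω ∩ Q = ∅ ∨ ω ∩ P = P ∨ hasE η)))
        then (1 : ℝ) else 0) = (TT.card : ℝ) := by rw [hTT, Finset.sum_boole]
  have ePP : (∑ ω ∈ (P ∪ Q ∪ O).powerset,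
        if 𝒱 ω ∧ ((ω ∩ P ≠ P ∧ ω ∩ Q ≠ Q ∧ noF (ω ∩ O) ∧ (ω ∩ P = ∅ ∨ ω ∩ Q = ∅ ∨ hasE (ω ∩ O))) ∧ hro (ω ∩ P) ∧ kro (ω ∩ Q))
        then (1 : ℝ) else 0) = (PP.card : ℝ) := by rw [hPP, Finset.sum_boole]
  rw [eTT, ePP]
  have hcard : (L1.card : ℝ) + (L2.card : ℝ) ≤ (TT.card : ℝ) + (PP.card : ℝ) := by
    have hnat : L1.card + L2.card ≤ TT.card + PP.card := by
      rw [← cIm1, ← cIm2, ← Finset.card_union_add_card_inter, cJ]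
      exact Nat.add_le_add (Finset.card_le_card subU) cJle
    exact_mod_cast hnat
  calc _ ≤ (L1.card : ℝ) + (L2.card : ℝ) := add_le_add (le_trans f1 (le_of_eq cL1)) (le_trans f2' (le_of_eq cL2))
    _ ≤ _ := hcard

end Coefficientwise

end Summit.CriticalPhenomena.PercolationContinuityZ3.Theorems
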